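import Summits.ValiantsHypothesis.ValiantsHypothesis.Theorems.BarrierLeverSigmaLambdaSigmaSliceCertificate
import Literature.ModelTheory.FiniteModelTheory.SymmetricCircuitCountingWidthProofs

/-!
# Route BarrierLever — the MODEL axis of crux `DefinableEquations` (stmt-ValiantsHypothesis-8745) /
# item `SingleSizeEquations` (8749): the `∃ a ∀ b` natural proof against the diagonal depth-3
# (`ΣΛΣ`) slice — part 2/2: non-vanishing, constructivity, and the headline

Continuation of `…SigmaLambdaSigmaSliceCertificate.lean` (the square-free catalecticant
`slsCert n` of coefficient variables and its vanishing on `sigmaLambdaSigmaSlice n s` whenever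
`s (n+1) < 2^{⌊n/2⌋}`).  Here: NON-VANISHING at the explicit witness `sqWitness n = Σ_S x^{2S}`
(degree `≤ n`; the evaluated matrix is diagonal with entries `2^{|S|}`,
`eval_slsCert_sqWitness_ne_zero`), CONSTRUCTIVITY (`slsCert_mem_distinguishers`: level 18), the
natural proof `isNaturalProof_slsCert`, the threshold arithmetic `n^b (n+1) < 2^{⌊n/2⌋}` for
`n ≥ 2 · 4^{b+2}`, and the HEADLINE `naturalProofsAgainstSigmaLambdaSigma` /
`sigmaLambdaSigmaSliceEquations`: ONE level `a = 18` such that for EVERY `b`, eventually, a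
nonzero level-`a` distinguisher (boolean sum with `q = 0`) vanishes on the coefficient vectors of
all sums of at most `n^b` powers (degree `≤ n`) of affine forms — the crux's sentence with its
quantifier order, on the `ΣΛΣ` slice; plus the explicit Waring-type bound
`sqWitness_not_mem_slice`.
WHAT THIS IS NOT: nothing on general circuits (the crux, CT23 dir. 2), homogeneous `ΣΠΣ`,
formulas beyond `n²/20`, 8746, 14610 or VP vs VNP; classical (Sylvester / Iarrobino–Kanev /
Nisan–Wigderson) mathematics made FSV-natural and kernel-checked.
-/

-- layout Summits/ValiantsHypothesis/ValiantsHypothesis forces the duplicated namespace component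
set_option linter.dupNamespace false

noncomputable section

open MvPolynomial Finsupp

namespace Summit.ValiantsHypothesis.ValiantsHypothesis.Theorems.BarrierLever.SigmaLambdaSigmaSlice

open Literature.Computability.AlgebraicComplexity Literature.Barriers.ValiantsHypothesis

section slice

variable {n : ℕ}

/-! ## Non-vanishing at the square-free witness -/

/-- `x^{S'} x^{S'} = x^T x^S` forces `S' = T = S`. [folklore] -/
theorem ind_add_self_eq_iff (S' S T : Finset (Fin (n / 2))) :
    ind n S' + ind n S' = ind n T + ind n S ↔ S' = T ∧ S' = S := by
  refine ⟨fun h => ?_, by rintro ⟨rfl, rfl⟩; rfl⟩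
  have key : ∀ i : Fin (n / 2), (i ∈ S' ↔ i ∈ T) ∧ (i ∈ S' ↔ i ∈ S) := by
    intro i
    have := DFunLike.congr_fun h (halfEmb n i)
    simp only [Finsupp.add_apply, ind_apply_halfEmb] at this
    by_cases h1 : i ∈ S' <;> by_cases h2 : i ∈ T <;> by_cases h3 : i ∈ S <;>
      simp [h1, h2, h3] at this ⊢
  exact ⟨Finset.ext fun i => (key i).1, Finset.ext fun i => (key i).2⟩

/-- The coefficients of the witness on the coordinates `c_{x^S x^T}`: the identity pattern.
[folklore] -/
theorem coeff_sqWitness (S T : Finset (Fin (n / 2))) :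
    coeff (ind n T + ind n S) (sqWitness n) = if S = T then 1 else 0 := by
  classical
  simp only [sqWitness, coeff_sum, coeff_monomial, ind_add_self_eq_iff]
  by_cases hST : S = T
  · subst hST
    rw [if_pos rfl, Finset.sum_eq_single S]
    · rw [if_pos ⟨rfl, rfl⟩]
    · intro S' _ hS'
      exact if_neg fun h => hS' h.1
    · simp
  · rw [if_neg hST]
    exact Finset.sum_eq_zero fun S' _ => if_neg fun h => hST (h.2.symm.trans h.1)

/-- The diagonal weights `w(S,S) = 2^{|S|}` are nonzero. [folklore] -/
theorem slsWeight_self_ne_zero (S : Finset (Fin (n / 2))) : (slsWeight n S S : ℂ) ≠ 0 := by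
  rw [slsWeight, Nat.cast_ne_zero, Finset.prod_ne_zero_iff]
  intro i hi
  have h1 : ind n S i = 1 := by
    have := ind_apply_le_one n S i
    have h0 := Finsupp.mem_support_iff.mp hi
    omega
  rw [Finsupp.add_apply, h1]
  decide

/-- **The certificate does not vanish at the witness** `F = Σ_S x^{2S}`: the evaluated matrix is
diagonal with entries `2^{|S|}`. [cite: IarrobinoKanev1999, §1.1] -/
theorem eval_slsCert_sqWitness_ne_zero :
    eval (coeffVector (degLEMonomials n) (sqWitness n)) (slsCert n) ≠ 0 := by
  classical
  rw [eval_slsCert]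
  have hM : (Matrix.of fun S T => (slsWeight n S T : ℂ) *
      coeffVector (degLEMonomials n) (sqWitness n) (slsCoord n S T)) =
      Matrix.diagonal fun S => (slsWeight n S S : ℂ) := by
    ext S T
    rw [Matrix.of_apply, coeffVector_apply, Matrix.diagonal_apply]
    show (slsWeight n S T : ℂ) * coeff (ind n T + ind n S) (sqWitness n) = _
    rw [coeff_sqWitness]
    split_ifs with h
    · subst h; rw [mul_one]
    · rw [mul_zero]
  rw [hM, Matrix.det_diagonal]
  exact Finset.prod_ne_zero_iff.mpr fun S _ => slsWeight_self_ne_zero S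

/-- `slsCert n ≠ 0`. [folklore] -/
theorem slsCert_ne_zero : slsCert n ≠ 0 := fun h =>
  eval_slsCert_sqWitness_ne_zero (n := n) (by rw [h, map_zero])

/-- The witness has degree `≤ n`. [folklore] -/
theorem totalDegree_sqWitness_le : (sqWitness n).totalDegree ≤ n := by
  classical
  refine (totalDegree_finsetSum _ _).trans (Finset.sup_le fun S _ => ?_)
  refine (totalDegree_monomial_le _ _).trans ?_
  have h := degree_ind_add_ind_le n S S
  simpa [Finsupp.sum, Finsupp.degree_apply] using h

/-! ## Constructivity: a level-18 distinguisher -/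

/-- `deg (slsCert n) ≤ 2^{⌊n/2⌋}`. [folklore] -/
theorem totalDegree_slsCert_le : (slsCert n).totalDegree ≤ 2 ^ (n / 2) := by
  classical
  refine (NaturalProofsAgainstAllLinearSizes.totalDegree_det_le_card _ fun S T => ?_).trans
    (by rw [Fintype.card_finset, Fintype.card_fin])
  rw [slsMatrix, Matrix.of_apply]
  refine (totalDegree_mul _ _).trans ?_
  rw [totalDegree_C, totalDegree_X, zero_add]

/-- `L(slsCert n) ≤ 8 (2^{⌊n/2⌋} + 1)⁷ + (2^{⌊n/2⌋})²`. [folklore] -/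
theorem complexity_slsCert_le :
    complexity (slsCert n) ≤ 8 * (2 ^ (n / 2) + 1) ^ 7 + (2 ^ (n / 2)) ^ 2 * 1 := by
  classical
  have h := NaturalProofsAgainstAllLinearSizes.complexity_det_le (slsMatrix n) 1 fun S T => by
    rw [slsMatrix, Matrix.of_apply]
    refine (complexity_mul_le_holds _ _).trans ?_
    rw [complexity_C_holds, complexity_X_holds]
  rwa [Fintype.card_finset, Fintype.card_fin] at h

/-- **Constructivity**: `slsCert n ∈ Distinguishers ℂ n 18` for `n ≥ 1`. [folklore] -/
theorem slsCert_mem_distinguishers (hn : 1 ≤ n) : slsCert n ∈ Distinguishers ℂ n 18 := by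
  set N := (2 * n).choose n with hNdef
  have h2N : 2 ^ n ≤ N := Literature.ModelTheory.FiniteModelTheory.two_pow_le_choose_two_mul_self n
  have hK : 2 ^ (n / 2) ≤ N :=
    (Nat.pow_le_pow_right (by norm_num) (Nat.div_le_self n 2)).trans h2N
  have hN2 : 2 ≤ N := le_trans (by
    calc (2 : ℕ) = 2 ^ 1 := by norm_num
      _ ≤ 2 ^ n := Nat.pow_le_pow_right (by norm_num) hn) h2N
  have h1024 : 1024 ≤ N ^ 10 := by
    calc (1024 : ℕ) = 2 ^ 10 := by norm_num
      _ ≤ N ^ 10 := Nat.pow_le_pow_left hN2 10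
  refine ⟨complexity_slsCert_le.trans ?_, totalDegree_slsCert_le.trans (hK.trans ?_)⟩
  · calc 8 * (2 ^ (n / 2) + 1) ^ 7 + (2 ^ (n / 2)) ^ 2 * 1
        ≤ 8 * (2 * N) ^ 7 + N ^ 2 := by
          have : 2 ^ (n / 2) + 1 ≤ 2 * N := by omega
          exact Nat.add_le_add (Nat.mul_le_mul_left 8 (Nat.pow_le_pow_left this 7))
            (by rw [mul_one]; exact Nat.pow_le_pow_left hK 2)
      _ = 1024 * N ^ 7 + N ^ 2 := by ring
      _ ≤ N ^ 10 * N ^ 7 + N ^ 17 := Nat.add_le_add (Nat.mul_le_mul_right _ h1024)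
          (Nat.pow_le_pow_right (by omega) (by norm_num))
      _ = 2 * N ^ 17 := by ring
      _ ≤ N * N ^ 17 := Nat.mul_le_mul_right _ hN2
      _ = N ^ 18 := by ring
  · calc N = N ^ 1 := (pow_one N).symm
      _ ≤ N ^ 18 := Nat.pow_le_pow_right (by omega) (by norm_num)

/-! ## The natural proof: one level, every size exponent -/

/-- **Natural proof against the diagonal depth-3 slice** at every top fan-in `s` with
`s (n + 1) < 2^{⌊n/2⌋}` (`n ≥ 1`). [cite: ForbesShpilkaVolk2018, Def. 1] -/
theorem isNaturalProof_slsCert {s : ℕ} (hn : 1 ≤ n) (hs : s * (n + 1) < 2 ^ (n / 2)) :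
    IsNaturalProof (degLEMonomials n) (sigmaLambdaSigmaSlice n s) (Distinguishers ℂ n 18)
      (slsCert n) :=
  ⟨slsCert_mem_distinguishers hn, slsCert_ne_zero, fun _ hf => eval_slsCert_eq_zero_of_mem hs hf⟩

/-- The threshold: `n^b (n + 1) < 2^{⌊n/2⌋}` for `n ≥ 2 · 4^{b+2}`. [folklore] -/
theorem pow_mul_succ_lt_two_pow_half {b n : ℕ} (hn : 2 * 4 ^ (b + 2) ≤ n) :
    n ^ b * (n + 1) < 2 ^ (n / 2) := by
  have hx4 : 4 ^ (b + 2) ≤ n / 2 := by omega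
  have hx1 : 4 ^ (b + 1) ≤ n / 2 :=
    le_trans (Nat.pow_le_pow_right (by norm_num) (by omega)) hx4
  have hxpos : 1 ≤ n / 2 := le_trans (Nat.one_le_pow _ 4 (by norm_num)) hx1
  have hn' : n + 1 ≤ 4 * (n / 2) := by omega
  have hnx : n ≤ 4 * (n / 2) := by omega
  calc n ^ b * (n + 1) ≤ (4 * (n / 2)) ^ b * (4 * (n / 2)) :=
        Nat.mul_le_mul (Nat.pow_le_pow_left hnx b) hn'
    _ = 4 ^ (b + 1) * (n / 2) ^ (b + 1) := by ring
    _ ≤ (n / 2) * (n / 2) ^ (b + 1) := Nat.mul_le_mul_right _ hx1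
    _ = (n / 2) ^ (b + 2) := by ring
    _ < 2 ^ (n / 2) := pow_lt_two_pow_of_le (b + 2) (n / 2) hx4

/-- **Largeness inside the slice**: the witness `sqWitness n` (degree `≤ n`) is a non-root of the
certificate, hence lies outside `sigmaLambdaSigmaSlice n s` whenever `s (n+1) < 2^{⌊n/2⌋}` —
an explicit Waring-type bound: `Σ_S x^{2S}` is not a sum of at most `s` powers (degree `≤ n`) of
affine forms. [cite: IarrobinoKanev1999, §1.1] -/
theorem sqWitness_not_mem_slice {s : ℕ} (hs : s * (n + 1) < 2 ^ (n / 2)) :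
    (sqWitness n).totalDegree ≤ n ∧ sqWitness n ∉ sigmaLambdaSigmaSlice n s :=
  ⟨totalDegree_sqWitness_le, fun hf =>
    eval_slsCert_sqWitness_ne_zero (eval_slsCert_eq_zero_of_mem hs hf)⟩

end slice

/-- **HEADLINE — the crux's quantifier shape `∃ a ∀ b` on the diagonal depth-3 slice.**  There is
ONE level `a` (`= 18`) such that for EVERY size exponent `b`, for all `n ≥ 2 · 4^{b+2}`, the
polynomials of degree `≤ n` in `n` variables that are sums of at most `n^b` powers of affine forms
are NOT a succinct hitting set for `Distinguishers ℂ n a` — i.e. `DefinableEquations` (item 8745,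
`∃ a ∀ b ∃ n₀ ∀ n ≥ n₀ …`) holds verbatim with `SmallCircuits ℂ n b` replaced by
`sigmaLambdaSigmaSlice n (n ^ b)`, with `q = 0` boolean variables.
[cite: NisanWigderson1996, §3] -/
theorem naturalProofsAgainstSigmaLambdaSigma : ∃ a : ℕ, ∀ b : ℕ, ∃ n₀ : ℕ, ∀ n ≥ n₀,
    ¬ IsSuccinctHittingSet (degLEMonomials n) (sigmaLambdaSigmaSlice n (n ^ b))
      (Distinguishers ℂ n a) := by
  refine ⟨18, fun b => ⟨2 * 4 ^ (b + 2), fun n hn => ?_⟩⟩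
  have hn1 : 1 ≤ n := le_trans (by have := Nat.one_le_pow (b + 2) 4 (by norm_num); omega) hn
  exact (exists_isNaturalProof_iff _ _ _).mp
    ⟨_, isNaturalProof_slsCert hn1 (pow_mul_succ_lt_two_pow_half hn)⟩

/-- **The 8745-shaped statement on the slice** (boolean-sum form): ONE level `a = 18` such that
for every `b` and all `n ≥ 2 · 4^{b+2}` a nonzero level-`a` boolean sum in the coefficient
variables (here with `q = 0` boolean variables) vanishes at `coeff f` for every
`f ∈ sigmaLambdaSigmaSlice n (n^b)`. [cite: NisanWigderson1996, §3] -/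
theorem sigmaLambdaSigmaSliceEquations : ∃ a : ℕ, ∀ b : ℕ, ∃ n₀ : ℕ, ∀ n ≥ n₀,
    ∃ q : ℕ, q ≤ (Nat.choose (2 * n) n) ^ a ∧
      ∃ H : MvPolynomial (↥(degLEMonomials n) ⊕ Fin q) ℂ,
        complexity H ≤ (Nat.choose (2 * n) n) ^ a ∧ H.totalDegree ≤ (Nat.choose (2 * n) n) ^ a ∧
        boolSum H ≠ 0 ∧
        ∀ f ∈ sigmaLambdaSigmaSlice n (n ^ b),
          eval (coeffVector (degLEMonomials n) f) (boolSum H) = 0 := by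
  refine ⟨18, fun b => ⟨2 * 4 ^ (b + 2), fun n hn =>
    ⟨0, Nat.zero_le _, MvPolynomial.rename Sum.inl (slsCert n), ?_⟩⟩⟩
  have hn1 : 1 ≤ n := le_trans (by have := Nat.one_le_pow (b + 2) 4 (by norm_num); omega) hn
  obtain ⟨hD, hne, hvan⟩ := isNaturalProof_slsCert hn1 (pow_mul_succ_lt_two_pow_half hn)
  obtain ⟨hc, hdeg, hsum⟩ := SingleSizeEquations.distinguisher_isBoolSum hD
  refine ⟨hc, hdeg, by rwa [hsum], fun f hf => ?_⟩
  rw [hsum]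
  exact hvan f hf

end Summit.ValiantsHypothesis.ValiantsHypothesis.Theorems.BarrierLever.SigmaLambdaSigmaSlice

end
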